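import Summits.QuantumFields.BalabanUV.Beta.CompositeOneShotJetData
import Summits.QuantumFields.BalabanUV.Beta.BubbleParity

/-!
# `BalabanUV.Beta.FP.CompositeOneShotChartParity` — road «FP» (binder row D1), R-FP-80 ∕ SPEC-51 §C–D «`hAσ_N ∕ hAσ_F` (small)», LATTICE LETTER:
# **THE COMPOSITE ONE-SHOT CHART IS sgn-SYMMETRIC** — `trK (compChart r L m s N) = sgnK (compChart r L m s N)` for every root list in its box and every
# in-block big root; at the record, **`trK (AN R j) = sgnK (AN R j)`** for every `R : Roots Lc` and every door index `j` — the tree's name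
# (`BorderedHessian.sgnK ∕ trK`, E-FP-40-2) for «the chart is graded-even at the lattice», i.e. exactly the hypothesis of road FP g40's bridge
# `PackedLawFullIndexGradedSocket.perF_gradedEven_of_trK_eq_sgnK` that discharges the v4 letter `hAσ_X` on every invariant box

WHY (located).  Road FP g40's R-FP-80 (journal l.67391) makes the door's second-order slot parity-blind and replaces the border-parity row `hW_Xt` by ONE chart-parity
letter per system, `hAσ_X : perF M_X A_X p q = s p.2·s q.2·perF M_X A_X q p`; INTENT-2 §2 discharges it for the coarse system (`GcombSh`, via an2's `trK_GcombSh`) and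
SPEC-51 §C–D lists `hAσ_N ∕ hAσ_F` as open «(small): from `XN = D_σ·Â` symmetric, or the row's `trK (AN R j) = sgnK (AN R j)` if typed».  It was not typed; THIS FILE
types it, for the generic composite chart `compChart r L m s N = Ψ̂_m ∘ coDressKBmAt (toSite s) N KInv ∘ Ψ̂_mᵀ` (`CompositeCorrectorDress.compChart`; `AN R j` is its
instance at `R.rc ∕ R.s (j+1) ∕ N = Lc^(j+1)`, `CompositeOneShotJetData.AN`; the F-system chart of the wrapper is the same term at its own roots): the corrector chart
`Ψ̂_m` is fibre-block-diagonal (`psiK_inl_inr ∕ psiK_inr_inl = 0`, `rfl`), hence `sgnK`-fixed; the co-dressed one-step resolvent is sgn-symmetric (an2's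
`BubbleParity.trK_coDressKBmAt` over `BorderedHessian.trK_KInv ∕ spr_KInv`); and a congruence `P ∘ X ∘ Pᵀ` by an `sgnK`-fixed spread `P` of a spread sgn-symmetric `X`
is sgn-symmetric (`trK_comp`, `comp_sgnK`, `comp_assoc_tame`).  With `NVertexSectorsPeriodised.AN_translate_invariant` (`Lc^(j+1) ∣ M i`) the road's bridge then reads
`hAσ_N` BY NAME — the one-line instantiation is the road's (its INTENT-2 is not in the tree at the time of writing; nothing of the road is imported here).

WHAT ([folklore] kernel-composition bookkeeping BY NAME; no `def`, no `def … : Prop`, nothing cited, 0 sorry): §1 `sgnK_psiK` (`Ψ̂_m` is `sgnK`-fixed), `sgnK_trK_psiK`,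
`trK_conj_eq_sgnK` (generic: `sgnK P = P`, `P ∕ X` spread, `trK X = sgnK X` ⟹ `trK (P∘X∘Pᵀ) = sgnK (P∘X∘Pᵀ)`); §2 **`trK_compChart`**; §3 **`trK_AN`** and its entrywise
reading `AN_apply_swap` (`AN R j y x b a = sgnF a · sgnF b · AN R j x y a b`).
WHAT THIS IS NOT: not `hAσ_N ∕ hAσ_F` on the torus (one line from the road's bridge once INTENT-2 lands — the road's), not the v4 wrapper, not (J-Λ); no row of the
END wrapper discharged; 0 estimates; nothing of Bałaban's asserted, valued or discharged; 0∕4 row-D1 binders (hW, hR, D1Tel, D1Rep); ROOT M‴ p325680 untouched;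
NOT (C1), NOT (L2′), NOT (T-ID), NOT SDF, NOT D1, NEVER «G-an2-4 closed», NOT BetaPertH, NOT continuum, NOT Clay.

HONEST DEPENDENCY (page 1, mandatory): continuum YM on T⁴ ⇐ BetaPertH ∧ nine spine estimates (0/9 proved); BetaPertH ⇐ (D1) ∧ (D4) ∧ CAP+tail;
G-an2-4 gates asym, D1 and NE2/3/4.  HONEST FRAMING (cell contract, verbatim): «discharging `BetaPertH` makes Bałaban's UV stability UNCONDITIONAL —
a real constructive-QFT result; it is NOT the continuum limit and NOT the Clay problem.»  ABSOLUTE RULE (cell charter, verbatim): «No internally-minted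
statement may enter as a cited fact. Every hypothesis is either kernel-proved in this package or a verbatim quotation of a PUBLISHED theorem with page
reference. The manuscript(s) under audit are NOT citable for their own disputed steps — they are the thing under adjudication; programme-internal
(2001/route/tribunal) claims are never citable.»  D1 formalisation swarm LEAF PROVER 03 (b2b-balaban-beta-d1-formalise-leaf-03 gen 56), 2026-08-27.  No existing file touched.
-/

noncomputable section

namespace Summit.QuantumFields.BalabanUV.Beta.FP.CompositeOneShotChartParity

open Literature.MathematicalPhysics.QuantumFieldTheory.Balaban1983to89
open Literature.MathematicalPhysics.QuantumFieldTheory.Balaban1983to89.Beta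
open ExpKernelCalculus (MKer comp)
open AffineAveraging (Site box toSite)
open OneStepResolventKernel (Fib KInv)
open Summit.QuantumFields.BalabanUV.Beta.TameKernelCalculus
open Summit.QuantumFields.BalabanUV.Beta.ChartConjugationRelative (spr_comp)
open Summit.QuantumFields.BalabanUV.Beta.AxialDressingRooted (coDressKBmAt spr_coDressKBmAt one_le_of_neZero)
open Summit.QuantumFields.BalabanUV.Beta.BorderedHessian (sgnF sgnK sgnK_apply sgnF_inl sgnF_inr comp_sgnK trK_sgnK spr_sgnK spr_KInv trK_KInv)
open Summit.QuantumFields.BalabanUV.Beta.CompositeCorrectorKernel (psiK psiK_inl_inr psiK_inr_inl spr_psiK spr_trK_psiK)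
open Summit.QuantumFields.BalabanUV.Beta.CompositeCorrectorDress (compChart)
open Summit.QuantumFields.BalabanUV.Beta.BubbleParity (trK_coDressKBmAt)
open Summit.QuantumFields.BalabanUV.Beta.CompositeOneShotJetData (Roots AN)

variable {d : ℕ}

/-! ## §1 The corrector chart is `sgnK`-fixed; congruence by an `sgnK`-fixed spread chart preserves sgn-symmetry -/

section Generic

/-- [folklore] **`Ψ̂_m` IS `sgnK`-FIXED**: the composite corrector chart has no field∕multiplier cross blocks (`psiK_inl_inr ∕ psiK_inr_inl`, `rfl`), so
`sgnK (psiK r L m) = psiK r L m` (`sgnF a · sgnF b = 1` on the diagonal blocks). -/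
theorem sgnK_psiK (r : ℕ → (Fin (d + 1) → ℕ)) (L m : ℕ) : sgnK (psiK r L m) = psiK r L m := by
  funext x y a b
  rw [sgnK_apply]
  rcases a with α | μ <;> rcases b with β | μ'
  · rw [sgnF_inl, sgnF_inl, one_mul, one_mul]
  · rw [psiK_inl_inr, mul_zero]
  · rw [psiK_inr_inl, mul_zero]
  · rw [sgnF_inr, sgnF_inr]; ring

/-- [folklore] hence its transpose is `sgnK`-fixed too (`trK_sgnK`). -/
theorem sgnK_trK_psiK (r : ℕ → (Fin (d + 1) → ℕ)) (L m : ℕ) : sgnK (trK (psiK r L m)) = trK (psiK r L m) := by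
  rw [← trK_sgnK, sgnK_psiK]

/-- [folklore] **CONGRUENCE BY AN `sgnK`-FIXED SPREAD CHART PRESERVES sgn-SYMMETRY**: for spread `P`, `X` with `sgnK P = P` and `trK X = sgnK X`,
`trK (P ∘ X ∘ Pᵀ) = sgnK (P ∘ X ∘ Pᵀ)` (`trK_comp` twice, `comp_sgnK` twice, one `comp_assoc_tame`). -/
theorem trK_conj_eq_sgnK {P X : MKer (d + 1) (Fib d)} (hP : Spr P) (hX : Spr X) (hPs : sgnK P = P) (hXt : trK X = sgnK X) :
    trK (comp (comp P X) (trK P)) = sgnK (comp (comp P X) (trK P)) := by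
  have hPt : sgnK (trK P) = trK P := by rw [← trK_sgnK, hPs]
  rw [trK_comp, trK_comp, trK_trK, hXt]
  -- right side: push `sgnK` through both compositions and drop it on the `sgnK`-fixed factors
  conv_rhs => rw [← comp_sgnK, ← comp_sgnK, hPs, hPt]
  exact comp_assoc_tame hP.tame (spr_sgnK hX).tame hP.trK.tame

end Generic

/-! ## §2 The composite one-shot chart is sgn-symmetric -/

section Chart

variable {L : ℕ} (hL : 0 < L) {r : ℕ → (Fin (d + 1) → ℕ)} (hr : ∀ k, r k ∈ box (d + 1) L) (m : ℕ)
include hL hr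

/-- [folklore] **`trK_compChart` — THE COMPOSITE ONE-SHOT CHART IS sgn-SYMMETRIC**: for a root list in its box and an in-block big root `s ∈ box N`,
`trK (compChart r L m s N) = sgnK (compChart r L m s N)` — `Ψ̂_m` is `sgnK`-fixed and spread (`sgnK_psiK`, `spr_psiK`), the co-dressed one-step resolvent is spread and
sgn-symmetric (`spr_coDressKBmAt ∕ trK_coDressKBmAt` over `spr_KInv ∕ trK_KInv`), and §1 `trK_conj_eq_sgnK`. -/
theorem trK_compChart {N : ℕ} [NeZero N] {s : Fin (d + 1) → ℕ} (hs : s ∈ box (d + 1) N) :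
    trK (compChart r L m s N) = sgnK (compChart r L m s N) :=
  trK_conj_eq_sgnK (spr_psiK hL hr m) (spr_coDressKBmAt (one_le_of_neZero N) hs spr_KInv) (sgnK_psiK r L m)
    (trK_coDressKBmAt (one_le_of_neZero N) hs spr_KInv (trK_KInv N))

end Chart

/-! ## §3 At the record: the N-system chart `AN R j` -/

section Record

variable {Lc : ℕ} [NeZero Lc] (R : Roots Lc) (j : ℕ)

/-- [folklore] **`trK_AN` — THE N-SYSTEM's ONE-SHOT CHART IS sgn-SYMMETRIC**: `trK (AN R j) = sgnK (AN R j)` for every record `R : Roots Lc` and every door index `j`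
(`AN R j = compChart R.rc Lc (j+1) (R.s (j+1)) (Lc^(j+1))`, `rfl`; §2 at `R.hrc ∕ R.hs (j+1)`).  This is the hypothesis `h` of road FP g40's bridge
`perF_gradedEven_of_trK_eq_sgnK`; with `NVertexSectorsPeriodised.AN_translate_invariant` it yields the v4 letter `hAσ_N` on every box with `Lc^(j+1) ∣ M i`. -/
theorem trK_AN : trK (AN R j) = sgnK (AN R j) :=
  trK_compChart (Nat.pos_of_ne_zero (NeZero.ne Lc)) R.hrc (j + 1) (R.hs (j + 1))

/-- [folklore] the same ENTRYWISE, in the lattice shape road FP's `perF_gradedEven_of_kernel` asks (`K x y a b = s a · s b · K y x b a`):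
`AN R j x y a b = sgnF a · sgnF b · AN R j y x b a`. -/
theorem AN_apply_swap (x y : Site (3 + 1)) (a b : Fib 3) : AN R j x y a b = sgnF a * sgnF b * AN R j y x b a := by
  have h := congrFun (congrFun (congrFun (congrFun (trK_AN R j) y) x) b) a
  rw [trK_apply, sgnK_apply] at h
  rw [h]; ring

end Record

end Summit.QuantumFields.BalabanUV.Beta.FP.CompositeOneShotChartParity

end
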